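import Literature.NumberTheory.Automorphic.ArchInnerFormPlaceNormalFormSplit
import Literature.NumberTheory.Automorphic.ArchInnerFormCartanAtlasRegular
import Literature.NumberTheory.Automorphic.ArchInnerFormCartanAtlasWeyl
import Literature.NumberTheory.Rogawski1990.ArchTransfFamily
import Literature.NumberTheory.Rogawski1990.ArchExplicitTransferFactorConjRight
import Literature.NumberTheory.Rogawski1990.LocalTransferCongruence
import HarnessLib

/-!
# Exhaustion of the regular set of the inner form `G′_∞ = U(diag α)(L⁺ ⊗ ℝ)` by the Cartan atlas: every regular semisimple `γ′` is `G′_∞`-conjugate to a regular chart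
# point `gprimeTorus α S′ c′`, `S′ ⊆` split-chart places ((EXH-G′) = (PARTNER) P2c, global assembly; Rogawski 1990 §3.1, §3.6; Knapp 1986 V §3)

Topic `NumberTheory/Automorphic`; namespace `Literature.NumberTheory.Automorphic.UnitaryGroup`.  THEOREMS ONLY (no `def`, no instance, no notation, no axiom, no
named fact, no `sorry`).  Cell `pub/hodgecm-mathlib`, crux H413 (`stmt-HodgeConjecture-24833`), F0∕P3c line LH3, DIRECT ROAD of `stub_N9`; organ **(EXH-G′)∕P2c** of
LH3-plan (g2) (06:28:37Z (4), FINAL-FINAL 06:41:49Z); seat LH7-p01 (g2).  The `G′`-side twin of ★ (EXH-H) `exists_conj_endoTorus_of_isArchGRegular`, assembled over the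
complex places from the two ONE-PLACE normal forms ★ `exists_unitary_conj_gprimeCptGL` (all eigenvalues unit ⇒ compact chart, LH3-p03 (g2) P2a) and ★
`exists_unitary_conj_gprimeSplitGL` (a non-unit eigenvalue ⇒ boost chart with `x ≠ 0`, and the place is a split-chart place, P2b).  Count-neutral.

THE MATHEMATICS.  House frame: `α_i ≠ 0`, `σ_w(α_i)` real at every complex place `w`, so `G′_w = U(diag a_w)(ℂ)` with `a_w = formRe L α w` (★ `diagonal_map_embedding_eq_of_real`).
Let `γ′ ∈ G′_∞` be regular (`charpoly` separable over `L ⊗ ℝ`, ★ `IsRegularElt`); then every place component `γ′_w` has separable characteristic polynomial (★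
`coe_archPiEquivCM_apply`, `charpoly_map`).  Let `S′` be the set of places where `γ′_w` has an eigenvalue off the unit circle.  At `w ∈ S′`, P2b conjugates `γ′_w` in
`G′_w` to the boost `gprimeSplitGL τ_w a_w (c′ w)` with `c′ w 0 ≠ 0` and shows `w ∈ splitChartPlaces L α`; at `w ∉ S′`, P2a conjugates it to the unit diagonal
`gprimeCptGL τ_w (c′ w)` (`τ_w = lineOf (formSign L α w)`).  These are exactly the place components ★ `gprimeBlock L α w S′ c′` of the chart, so gluing the place
conjugators through ★ `archPiEquivCM` gives `γ′ = g · gprimeTorus L α S′ c′ · g⁻¹`; and `c′ ∈ RegG S′` because regularity is a class invariant (★ `isRegularElt_conj_iff`)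
and reads `RegG` on the chart (★ `isRegularElt_gprimeTorus_iff_mem_regG`).
* §1 place bookkeeping: `mem_unitaryGroupOfForm_formRe_of_mem_archLocal`, `charpoly_archPiEquivCM_separable_of_isRegularElt`, `exists_conj_gprimeBlock`;
* §2 **`exists_conj_gprimeTorus_of_isRegularElt`** (= (EXH-G′));
* §3 (ED. 2) **`forall_conjClasses_eq_mk_gprimeTorus_slotPerm`** (= (PARTNER) hP2: the norm partners of a regular `H`-chart point `endoTorus S c` are the classes of
  the partner family `gprimeTorus α S (slotPerm ρ c)`, `ρ ∈ partnerPerms S`), with `isConj_gprimeTorus_flip` (★ NEGX-CONJ at a set of split places),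
  `gprimeCptGL_congr` ∕ `gprimeSplitGL_congr` (`2π`-periodicity: chart points with the same unit phases are equal).
HONEST LABEL: HC_CM is proved only modulo the 7 printed citations (2 remaining: hLiu418 = `stmt-HodgeConjecture-24832`, h413 = `stmt-HodgeConjecture-24833`) until rung 0
closes; chart bookkeeping, count-neutral (+0∕+0).

## References
* [Rogawski1990] J. D. Rogawski, *Automorphic Representations of Unitary Groups in Three Variables*, Ann. of Math. Stud. 123 (1990), §3.1 p. 19 (regular elements),
  §3.6 p. 31 (the Cartan subgroups of `U(2,1)` and `U(3)`), §4.3 p. 42.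
* [Knapp1986] A. W. Knapp, *Representation Theory of Semisimple Groups* (1986), Ch. V §3 (every regular element lies in a Cartan subgroup; finitely many classes of Cartans).
-/

set_option autoImplicit false

noncomputable section

open NumberField NumberField.InfinitePlace NumberField.mixedEmbedding Matrix Complex Polynomial
open scoped MatrixGroups Matrix ComplexConjugate Real Classical

namespace Literature.NumberTheory.Automorphic.UnitaryGroup

open Literature.NumberTheory.Rogawski1990 Literature.NumberTheory.Automorphic.ArchCartan

/-! ## §1 Place bookkeeping -/

section Place

variable (L : Type) [Field L] [NumberField L] [IsCMField L] (α : Fin 3 → L)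

omit [NumberField L] [IsCMField L] in
/-- In the house frame the place group `G′_w = U(σ_w diag α)(ℂ)` is `U(diag a_w)(ℂ)`, `a_w = formRe L α w`: membership transfer. [cite: Rogawski1990, §3.6 p. 31] -/
theorem mem_unitaryGroupOfForm_formRe_of_mem_archLocal {w : {w : InfinitePlace L // IsComplex w}} (hreal : ∀ i, (w.1.embedding (α i)).im = 0)
    {g : GL (Fin 3) ℂ} (hg : g ∈ archLocal L 3 (Matrix.diagonal α) w) :
    g ∈ unitaryGroupOfForm (starRingEnd ℂ) (Matrix.diagonal fun i => ((formRe L α w i : ℝ) : ℂ)) := by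
  have h : g ∈ unitaryGroupOfForm (starRingEnd ℂ) ((Matrix.diagonal α).map w.1.embedding) := hg
  rwa [diagonal_map_embedding_eq_of_real hreal] at h

omit [NumberField L] [IsCMField L] in
/-- Converse membership transfer: `U(diag a_w)(ℂ) ⊆ G′_w`. [cite: Rogawski1990, §3.6 p. 31] -/
theorem mem_archLocal_of_mem_unitaryGroupOfForm_formRe {w : {w : InfinitePlace L // IsComplex w}} (hreal : ∀ i, (w.1.embedding (α i)).im = 0)
    {g : GL (Fin 3) ℂ} (hg : g ∈ unitaryGroupOfForm (starRingEnd ℂ) (Matrix.diagonal fun i => ((formRe L α w i : ℝ) : ℂ))) :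
    g ∈ archLocal L 3 (Matrix.diagonal α) w := by
  show g ∈ unitaryGroupOfForm (starRingEnd ℂ) ((Matrix.diagonal α).map w.1.embedding)
  rwa [diagonal_map_embedding_eq_of_real hreal]

/-- **A regular `γ′ ∈ G′_∞` has separable characteristic polynomial at every complex place** (the place component is `GL₃(evalC w) γ′`, ★ `coe_archPiEquivCM_apply`).
[cite: Rogawski1990, §3.1 p. 19] -/
theorem charpoly_archPiEquivCM_separable_of_isRegularElt (γ : ↥(arch (↥(maximalRealSubfield L)) L (IsCMField.complexConj L) 3 (Matrix.diagonal α)))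
    (hreg : IsRegularElt (γ : GL (Fin 3) (mixedSpace L))) (w : {w : InfinitePlace L // IsComplex w}) :
    (((archPiEquivCM 3 L (Matrix.diagonal α) γ w : ↥(archLocal L 3 (Matrix.diagonal α) w)) : GL (Fin 3) ℂ) : Matrix (Fin 3) (Fin 3) ℂ).charpoly.Separable := by
  have hval : (((archPiEquivCM 3 L (Matrix.diagonal α) γ w : ↥(archLocal L 3 (Matrix.diagonal α) w)) : GL (Fin 3) ℂ) : Matrix (Fin 3) (Fin 3) ℂ) =
      (((γ : GL (Fin 3) (mixedSpace L))) : Matrix (Fin 3) (Fin 3) (mixedSpace L)).map (evalC L w) := by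
    rw [coe_archPiEquivCM_apply]
    rfl
  rw [hval, Matrix.charpoly_map]
  exact (Polynomial.Separable.map hreg)

variable {L α} in
/-- **The place normal form, packaged on the chart component ★ `gprimeBlock`**: for a regular `γ′` and the set `S′` of places with a non-unit eigenvalue, every place
component `γ′_w` is `G′_w`-conjugate to `gprimeBlock L α w S′ c` for some coordinates depending only on `w` (P2a off `S′`, P2b on `S′`). [cite: Rogawski1990, §3.6 p. 31]
[cite: Knapp1986, Ch. V §3] -/
theorem exists_conj_gprimeBlock (hα : ∀ i, α i ≠ 0) (hreal : ∀ (w : {w : InfinitePlace L // IsComplex w}) (i : Fin 3), (w.1.embedding (α i)).im = 0)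
    (γ : ↥(arch (↥(maximalRealSubfield L)) L (IsCMField.complexConj L) 3 (Matrix.diagonal α))) (hreg : IsRegularElt (γ : GL (Fin 3) (mixedSpace L)))
    (S' : Finset {w : InfinitePlace L // IsComplex w})
    (hS' : ∀ w, w ∈ S' ↔ ∃ z : ℂ, (((archPiEquivCM 3 L (Matrix.diagonal α) γ w : ↥(archLocal L 3 (Matrix.diagonal α) w)) : GL (Fin 3) ℂ) :
      Matrix (Fin 3) (Fin 3) ℂ).charpoly.IsRoot z ∧ ‖z‖ ≠ 1)
    (w : {w : InfinitePlace L // IsComplex w}) :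
    (w ∈ S' → w ∈ splitChartPlaces L α) ∧
    ∃ (k : ↥(archLocal L 3 (Matrix.diagonal α) w)) (cw : Fin 3 → ℝ), (w ∈ S' → cw 0 ≠ 0) ∧ (w ∉ S' → Function.Injective fun i : Fin 3 => Circle.exp (cw i)) ∧
      ((archPiEquivCM 3 L (Matrix.diagonal α) γ w : ↥(archLocal L 3 (Matrix.diagonal α) w)) : GL (Fin 3) ℂ) =
        (k : GL (Fin 3) ℂ) * ((gprimeBlock L α w S' (fun _ => cw) : ↥(archLocal L 3 (Matrix.diagonal α) w)) : GL (Fin 3) ℂ) * (k : GL (Fin 3) ℂ)⁻¹ := by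
  have hmem := mem_unitaryGroupOfForm_formRe_of_mem_archLocal L α (hreal w) (archPiEquivCM 3 L (Matrix.diagonal α) γ w).2
  have hsep := charpoly_archPiEquivCM_separable_of_isRegularElt L α γ hreg w
  have he : ∀ i, formRe L α w i ≠ 0 := formRe_ne_zero hα (hreal w)
  have hfs : formSign L α w = fun i => SignType.sign (formRe L α w i) := rfl
  by_cases hw : w ∈ S'
  · obtain ⟨hsplit, k, hk, cw, hc0, hγ⟩ := exists_unitary_conj_gprimeSplitGL he hmem hsep ((hS' w).1 hw)
    have hsp : w ∈ splitChartPlaces L α := ⟨hreal w, by rw [hfs]; exact hsplit⟩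
    refine ⟨fun _ => hsp, ⟨k, mem_archLocal_of_mem_unitaryGroupOfForm_formRe L α (hreal w) hk⟩, cw, fun _ => hc0, fun h => absurd hw h, ?_⟩
    rw [coe_gprimeBlock_of_mem L α (fun _ => cw) hw hsp, hfs]
    exact hγ
  · have hunit : ∀ z : ℂ, (((archPiEquivCM 3 L (Matrix.diagonal α) γ w : ↥(archLocal L 3 (Matrix.diagonal α) w)) : GL (Fin 3) ℂ) :
        Matrix (Fin 3) (Fin 3) ℂ).charpoly.IsRoot z → ‖z‖ = 1 := by
      intro z hz
      by_contra hne
      exact hw ((hS' w).2 ⟨z, hz, hne⟩)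
    obtain ⟨k, hk, cw, hinj, hγ⟩ := exists_unitary_conj_gprimeCptGL he hmem hsep hunit (lineOf (formSign L α w))
    refine ⟨fun h => absurd h hw, ⟨k, mem_archLocal_of_mem_unitaryGroupOfForm_formRe L α (hreal w) hk⟩, cw, fun h => absurd h hw, fun _ => hinj, ?_⟩
    rw [coe_gprimeBlock_of_not_mem L α (fun _ => cw) hw]
    exact hγ

end Place

/-! ## §2 Exhaustion of the regular set of `G′_∞` by the charts -/

section Global

variable (L : Type) [Field L] [NumberField L] [IsCMField L] (α : Fin 3 → L)

/-- **(EXH-G′) EVERY REGULAR ELEMENT OF `G′_∞` IS `G′_∞`-CONJUGATE TO A REGULAR CHART POINT**: in the house frame (`α_i ≠ 0`, `σ_w(α_i)` real), for `γ′ ∈ G′_∞ =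
U(diag α)(L⁺ ⊗ ℝ)` regular there are a chart `S′ ⊆` split-chart places, coordinates `c′ ∈ RegG S′` and `g ∈ G′_∞` with `γ′ = g · gprimeTorus L α S′ c′ · g⁻¹`.
`S′` is the set of places at which `γ′` has an eigenvalue off the unit circle. [cite: Rogawski1990, §3.6 p. 31; §3.1 p. 19] [cite: Knapp1986, Ch. V §3] -/
theorem exists_conj_gprimeTorus_of_isRegularElt (hα : ∀ i, α i ≠ 0) (hreal : ∀ (w : {w : InfinitePlace L // IsComplex w}) (i : Fin 3), (w.1.embedding (α i)).im = 0)
    (γ : ↥(arch (↥(maximalRealSubfield L)) L (IsCMField.complexConj L) 3 (Matrix.diagonal α))) (hreg : IsRegularElt (γ : GL (Fin 3) (mixedSpace L))) :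
    ∃ (S' : Finset {w : InfinitePlace L // IsComplex w}) (c : {w : InfinitePlace L // IsComplex w} → Fin 3 → ℝ)
      (g : ↥(arch (↥(maximalRealSubfield L)) L (IsCMField.complexConj L) 3 (Matrix.diagonal α))),
      (∀ w, w ∈ S' → w ∈ splitChartPlaces L α) ∧ c ∈ ArchCartan.RegG S' ∧ γ = g * gprimeTorus L α S' c * g⁻¹ := by
  -- the places with a non-unit eigenvalue
  set S' : Finset {w : InfinitePlace L // IsComplex w} := Finset.univ.filter fun w =>
    ∃ z : ℂ, (((archPiEquivCM 3 L (Matrix.diagonal α) γ w : ↥(archLocal L 3 (Matrix.diagonal α) w)) : GL (Fin 3) ℂ) :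
      Matrix (Fin 3) (Fin 3) ℂ).charpoly.IsRoot z ∧ ‖z‖ ≠ 1 with hS'def
  have hS' : ∀ w, w ∈ S' ↔ ∃ z : ℂ, (((archPiEquivCM 3 L (Matrix.diagonal α) γ w : ↥(archLocal L 3 (Matrix.diagonal α) w)) : GL (Fin 3) ℂ) :
      Matrix (Fin 3) (Fin 3) ℂ).charpoly.IsRoot z ∧ ‖z‖ ≠ 1 := fun w => by
    rw [hS'def, Finset.mem_filter]; exact ⟨fun h => h.2, fun h => ⟨Finset.mem_univ w, h⟩⟩
  have key := exists_conj_gprimeBlock hα hreal γ hreg S' hS'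
  have hsub : ∀ w, w ∈ S' → w ∈ splitChartPlaces L α := fun w hw => (key w).1 hw
  choose k c hc0 hinj hkc using fun w => (key w).2
  -- the global conjugator
  set g : ↥(arch (↥(maximalRealSubfield L)) L (IsCMField.complexConj L) 3 (Matrix.diagonal α)) := (archPiEquivCM 3 L (Matrix.diagonal α)).symm k with hg
  have hconj : γ = g * gprimeTorus L α S' c * g⁻¹ := by
    apply (archPiEquivCM 3 L (Matrix.diagonal α)).injective
    rw [map_mul, map_mul, map_inv, hg, ContinuousMulEquiv.apply_symm_apply]
    funext w
    rw [Pi.mul_apply, Pi.mul_apply, Pi.inv_apply, archPiEquivCM_gprimeTorus]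
    apply Subtype.ext
    rw [Subgroup.coe_mul, Subgroup.coe_mul, Subgroup.coe_inv, hkc w]
    rfl
  refine ⟨S', c, g, hsub, ?_, hconj⟩
  -- regularity on the chart
  rw [← isRegularElt_gprimeTorus_iff_mem_regG L α S' c hsub]
  have hval : ((g * gprimeTorus L α S' c * g⁻¹ : ↥(arch (↥(maximalRealSubfield L)) L (IsCMField.complexConj L) 3 (Matrix.diagonal α))) : GL (Fin 3) (mixedSpace L)) =
      (g : GL (Fin 3) (mixedSpace L)) * (gprimeTorus L α S' c : GL (Fin 3) (mixedSpace L)) * (g : GL (Fin 3) (mixedSpace L))⁻¹ := by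
    rw [Subgroup.coe_mul, Subgroup.coe_mul, Subgroup.coe_inv]
  rw [hconj, hval, isRegularElt_conj_iff] at hreg
  exact hreg

end Global


/-! ## §3 (ED. 2) Norm partners of an `H`-chart point are the classes of the partner family ((PARTNER) hP2) -/

section Partner

variable (L : Type) [Field L] [NumberField L] [IsCMField L] (α : Fin 3 → L)

/-- Two compact chart points with the same unit eigenvalue on each line are EQUAL (`2π`-periodicity of the angles). [cite: Rogawski1990, §3.6 p. 31] -/
theorem gprimeCptGL_congr (τ : Fin 3 ≃ Fin 3) {c c' : Fin 3 → ℝ} (h : ∀ i, Complex.exp ((c i : ℂ) * I) = Complex.exp ((c' i : ℂ) * I)) :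
    gprimeCptGL τ c = gprimeCptGL τ c' := by
  apply Units.ext
  rw [coe_gprimeCptGL, coe_gprimeCptGL]
  congr 1
  funext ℓ
  exact h _

/-- Two boosts with the same `x` and the same unit phases `e^{iφ}`, `e^{iθ}` are EQUAL. [cite: Knapp1986, Ch. V §3] -/
theorem gprimeSplitGL_congr (τ : Fin 3 ≃ Fin 3) (a : Fin 3 → ℝ) {c c' : Fin 3 → ℝ} (h0 : c 0 = c' 0)
    (h1 : Complex.exp ((c 1 : ℂ) * I) = Complex.exp ((c' 1 : ℂ) * I)) (h2 : Complex.exp ((c 2 : ℂ) * I) = Complex.exp ((c' 2 : ℂ) * I)) :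
    gprimeSplitGL τ a c = gprimeSplitGL τ a c' := by
  apply Units.ext
  rw [coe_gprimeSplitGL, coe_gprimeSplitGL, gprimeSplitMatrix, gprimeSplitMatrix, boostStd, boostStd, h0, h1, h2]

/-- `‖e^{x + iθ}‖ = e^x`. [cite: Knapp1986, Ch. V §3] -/
theorem norm_exp_ofReal_add_ofReal_mul_I (x θ : ℝ) : ‖Complex.exp ((x : ℂ) + (θ : ℂ) * I)‖ = Real.exp x := by
  rw [Complex.norm_exp]
  simp

/-- `‖e^{−x + iθ}‖ = e^{−x}`. [cite: Knapp1986, Ch. V §3] -/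
theorem norm_exp_neg_ofReal_add_ofReal_mul_I (x θ : ℝ) : ‖Complex.exp (-(x : ℂ) + (θ : ℂ) * I)‖ = Real.exp (-x) := by
  rw [Complex.norm_exp]
  simp

/-- `e^{x + iθ} = e^{x′ + iθ′}` forces `x = x′` and `e^{iθ} = e^{iθ′}`. [cite: Knapp1986, Ch. V §3] -/
theorem eq_and_exp_eq_of_exp_add_eq {x x' θ θ' : ℝ} (h : Complex.exp ((x : ℂ) + (θ : ℂ) * I) = Complex.exp ((x' : ℂ) + (θ' : ℂ) * I)) :
    x = x' ∧ Complex.exp ((θ : ℂ) * I) = Complex.exp ((θ' : ℂ) * I) := by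
  have hx : x = x' := by
    have hn := congrArg (fun z : ℂ => ‖z‖) h
    simp only [norm_exp_ofReal_add_ofReal_mul_I] at hn
    exact Real.exp_injective hn
  refine ⟨hx, ?_⟩
  rw [hx, Complex.exp_add, Complex.exp_add] at h
  exact mul_left_cancel₀ (Complex.exp_ne_zero _) h

/-- The elements `j ≠ 1` of `Fin 3` are `0` and `2`. [cite: Knapp1986, Ch. V §3] -/
theorem fin_three_eq_zero_or_two : ∀ j : Fin 3, j ≠ 1 → j = 0 ∨ j = 2 := by decide

variable (S : Finset {w : InfinitePlace L // IsComplex w}) (c : {w : InfinitePlace L // IsComplex w} → Fin 3 → ℝ)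

/-- **Flipping `x_w ↦ −x_w` at a set `T ⊆ S` of split places stays in the `G′_∞`-class** (★ (NEGX-CONJ) `gprimeTorus_negXAt_eq_conj`, one place at a time).
[cite: Rogawski1990, §3.6 p. 31] [cite: Knapp1986, Ch. V §3] -/
theorem isConj_gprimeTorus_flip (hS : ∀ w, w ∈ S → w ∈ splitChartPlaces L α) (T : Finset {w : InfinitePlace L // IsComplex w}) (hT : T ⊆ S) :
    IsConj (gprimeTorus L α S c) (gprimeTorus L α S fun w => if w ∈ T then ![-(c w 0), c w 1, c w 2] else c w) := by
  induction T using Finset.induction_on with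
  | empty => simp only [Finset.notMem_empty, if_false]; exact IsConj.refl _
  | insert w T hwT ih =>
    have hw : w ∈ S := hT (Finset.mem_insert_self w T)
    have ih' := ih ((Finset.subset_insert w T).trans hT)
    have hstep : gprimeTorus L α S (fun w' => if w' ∈ insert w T then ![-(c w' 0), c w' 1, c w' 2] else c w') =
        gprimeTorus L α S (negXAt w fun w' => if w' ∈ T then ![-(c w' 0), c w' 1, c w' 2] else c w') := by
      refine gprimeTorus_congr L α S fun w' i => ?_
      by_cases hw' : w' = w
      · subst hw'
        rw [negXAt_apply_self, if_pos (Finset.mem_insert_self w' T), if_neg hwT]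
      · rw [negXAt_apply_of_ne hw']
        by_cases hT' : w' ∈ T
        · rw [if_pos (Finset.mem_insert_of_mem hT'), if_pos hT']
        · rw [if_neg hT', if_neg (fun h => (Finset.mem_insert.1 h).elim hw' hT')]
    rw [hstep, gprimeTorus_negXAt_eq_conj L α hw (hS w hw)]
    exact ih'.trans ((isConj_iff.2 ⟨_, rfl⟩))

/-- **(hP2) THE NORM PARTNERS OF A REGULAR `H`-CHART POINT ARE THE CLASSES OF THE PARTNER FAMILY.**  House frame (`α_i ≠ 0`, `σ_w(α_i)` real), `S ⊆` split-chart
places, `c ∈ RegG S`: every conjugacy class `c′` of `G′_∞` in norm-pair position with `endoTorus L S c` is the class of `gprimeTorus L α S (slotPerm ρ c)` for some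
`ρ ∈ partnerPerms S` (identity at the split places, any slot permutation at the compact ones).  Route: `Quotient.out c′` is regular (the norm pair transports
regularity, ★ `isRegularElt_iff_of_corresponds`), so (EXH-G′) conjugates it to a regular chart point `gprimeTorus α S′ c″`; the place-by-place eigenvalue matching ★
`isArchNormPair_endoTorus_gprimeTorus_iff` forces `S′ = S` (NORMS: `e^{±x} ≠ 1`), `e^{iφ″} = e^{iφ}`, `e^{iθ″} = e^{iθ}`, `x″ = ±x` at `w ∈ S` and `e^{ic″_i} = e^{ic_{σ i}}`
off `S`; the `−x` places are flipped back inside the class (`isConj_gprimeTorus_flip`), after which the chart points are EQUAL. [cite: Rogawski1990, §3.6 p. 31; §4.3 p. 42;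
§14.3 p. 234] [cite: Knapp1986, Ch. V §3] [cite: Shelstad1979, §4 p. 23] -/
theorem forall_conjClasses_eq_mk_gprimeTorus_slotPerm (hα : ∀ i, α i ≠ 0)
    (hreal : ∀ (w : {w : InfinitePlace L // IsComplex w}) (i : Fin 3), (w.1.embedding (α i)).im = 0)
    (hS : ∀ w, w ∈ S → w ∈ splitChartPlaces L α) (hc : c ∈ ArchCartan.RegG S) :
    ∀ c' : ConjClasses ↥(arch (↥(maximalRealSubfield L)) L (IsCMField.complexConj L) 3 (Matrix.diagonal α)),
      IsArchNormPair L (Matrix.diagonal α) (endoTorus L S c) (Quotient.out c') →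
        ∃ ρ ∈ partnerPerms S, c' = ConjClasses.mk (gprimeTorus L α S (slotPerm ρ c)) := by
  intro c' hnp
  set γ' : ↥(arch (↥(maximalRealSubfield L)) L (IsCMField.complexConj L) 3 (Matrix.diagonal α)) := Quotient.out c' with hγ'
  have hout : ConjClasses.mk γ' = c' := by rw [hγ', ← ConjClasses.quotient_mk_eq_mk]; exact Quotient.out_eq c'
  -- `γ′` is regular
  have hregH : IsArchGRegular L (endoTorus L S c) := (isArchGRegular_endoTorus_iff_mem_regG L S c).2 hc
  have hreg : IsRegularElt (γ' : GL (Fin 3) (mixedSpace L)) :=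
    (isRegularElt_iff_of_corresponds ((isArchNormPair_iff L (Matrix.diagonal α) _ _).1 hnp)).1 hregH
  -- (EXH-G′)
  obtain ⟨S', c'', g, hS', hc'', hconj⟩ := exists_conj_gprimeTorus_of_isRegularElt L α hα hreal γ' hreg
  have hnp' : IsArchNormPair L (Matrix.diagonal α) (endoTorus L S c) (gprimeTorus L α S' c'') := by
    rw [hconj] at hnp
    exact (isArchNormPair_conj_right L (Matrix.diagonal α) (endoTorus L S c) (gprimeTorus L α S' c'') g).1 hnp
  have hplace := (isArchNormPair_endoTorus_gprimeTorus_iff L α S S' c c'' hS').1 hnp'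
  have hx : ∀ w, w ∈ S → c w 0 ≠ 0 := ((ArchCartan.mem_regG_iff S c).1 hc).2
  have hx'' : ∀ w, w ∈ S' → c'' w 0 ≠ 0 := ((ArchCartan.mem_regG_iff S' c'').1 hc'').2
  -- the chart sets agree
  have hSS : S' = S := by
    ext w
    obtain ⟨σ, hσ⟩ := hplace w
    constructor
    · intro hw'
      by_contra hw
      have h : Complex.exp ((c'' w 0 : ℂ) + (c'' w 2 : ℂ) * I) = Complex.exp ((c w (σ 0) : ℂ) * I) := by
        have h0 := hσ 0; rw [if_pos hw', if_neg hw] at h0; exact h0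
      have hn := congrArg (fun z : ℂ => ‖z‖) h
      simp only [norm_exp_ofReal_add_ofReal_mul_I, Complex.norm_exp_ofReal_mul_I] at hn
      exact hx'' w hw' ((Real.exp_eq_one_iff _).1 hn)
    · intro hw
      by_contra hw'
      have h : Complex.exp ((c'' w (σ.symm 0) : ℂ) * I) = Complex.exp ((c w 0 : ℂ) + (c w 2 : ℂ) * I) := by
        have h0 := hσ (σ.symm 0); rw [if_neg hw', if_pos hw, Equiv.apply_symm_apply] at h0; exact h0
      have hn := congrArg (fun z : ℂ => ‖z‖) h
      simp only [norm_exp_ofReal_add_ofReal_mul_I, Complex.norm_exp_ofReal_mul_I] at hn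
      exact hx w hw ((Real.exp_eq_one_iff _).1 hn.symm)
  subst hSS
  -- per-place reading of the matching
  have hsplit : ∀ w, w ∈ S' → (c'' w 0 = c w 0 ∨ c'' w 0 = -(c w 0)) ∧
      Complex.exp ((c'' w 1 : ℂ) * I) = Complex.exp ((c w 1 : ℂ) * I) ∧ Complex.exp ((c'' w 2 : ℂ) * I) = Complex.exp ((c w 2 : ℂ) * I) := by
    intro w hw
    obtain ⟨σ, hσ⟩ := hplace w
    -- the `H` triple as a function, evaluated
    have hH : ∀ j : Fin 3, (![Complex.exp ((c w 0 : ℂ) + (c w 2 : ℂ) * I), Complex.exp ((c w 1 : ℂ) * I), Complex.exp (-(c w 0 : ℂ) + (c w 2 : ℂ) * I)] :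
        Fin 3 → ℂ) j = if j = 0 then Complex.exp ((c w 0 : ℂ) + (c w 2 : ℂ) * I) else if j = 1 then Complex.exp ((c w 1 : ℂ) * I)
          else Complex.exp (-(c w 0 : ℂ) + (c w 2 : ℂ) * I) := by
      intro j; fin_cases j <;> rfl
    have hG : ∀ i : Fin 3, boostEig (c'' w) i = (![Complex.exp ((c w 0 : ℂ) + (c w 2 : ℂ) * I), Complex.exp ((c w 1 : ℂ) * I),
        Complex.exp (-(c w 0 : ℂ) + (c w 2 : ℂ) * I)] : Fin 3 → ℂ) (σ i) := by
      intro i; have h0 := hσ i; rw [if_pos hw, if_pos hw] at h0; exact h0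
    have h1 : σ 1 = 1 := by
      by_contra hne
      have h : Complex.exp ((c'' w 1 : ℂ) * I) = (![Complex.exp ((c w 0 : ℂ) + (c w 2 : ℂ) * I), Complex.exp ((c w 1 : ℂ) * I),
          Complex.exp (-(c w 0 : ℂ) + (c w 2 : ℂ) * I)] : Fin 3 → ℂ) (σ 1) := hG 1
      rw [hH] at h
      rcases fin_three_eq_zero_or_two (σ 1) hne with h0 | h2
      · rw [h0, if_pos rfl] at h
        have hn := congrArg (fun z : ℂ => ‖z‖) h
        simp only [norm_exp_ofReal_add_ofReal_mul_I, Complex.norm_exp_ofReal_mul_I] at hn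
        exact hx w hw ((Real.exp_eq_one_iff _).1 hn.symm)
      · rw [h2, if_neg (by decide), if_neg (by decide)] at h
        have hn := congrArg (fun z : ℂ => ‖z‖) h
        simp only [norm_exp_neg_ofReal_add_ofReal_mul_I, Complex.norm_exp_ofReal_mul_I] at hn
        exact hx w hw (neg_eq_zero.1 ((Real.exp_eq_one_iff _).1 hn.symm))
    have hφ : Complex.exp ((c'' w 1 : ℂ) * I) = Complex.exp ((c w 1 : ℂ) * I) := by
      have h : Complex.exp ((c'' w 1 : ℂ) * I) = (![Complex.exp ((c w 0 : ℂ) + (c w 2 : ℂ) * I), Complex.exp ((c w 1 : ℂ) * I),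
          Complex.exp (-(c w 0 : ℂ) + (c w 2 : ℂ) * I)] : Fin 3 → ℂ) (σ 1) := hG 1
      rw [h1] at h
      exact h
    have h0ne : σ 0 ≠ 1 := fun h => absurd (σ.injective (h.trans h1.symm)) (by decide)
    have hG0 : Complex.exp ((c'' w 0 : ℂ) + (c'' w 2 : ℂ) * I) = (![Complex.exp ((c w 0 : ℂ) + (c w 2 : ℂ) * I), Complex.exp ((c w 1 : ℂ) * I),
        Complex.exp (-(c w 0 : ℂ) + (c w 2 : ℂ) * I)] : Fin 3 → ℂ) (σ 0) := hG 0
    rw [hH] at hG0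
    rcases fin_three_eq_zero_or_two (σ 0) h0ne with h00 | h02
    · rw [h00, if_pos rfl] at hG0
      obtain ⟨hxx, hθ⟩ := eq_and_exp_eq_of_exp_add_eq hG0
      exact ⟨Or.inl hxx, hφ, hθ⟩
    · rw [h02, if_neg (by decide), if_neg (by decide), ← Complex.ofReal_neg] at hG0
      obtain ⟨hxx, hθ⟩ := eq_and_exp_eq_of_exp_add_eq hG0
      exact ⟨Or.inr hxx, hφ, hθ⟩
  have hcpt : ∀ w, w ∉ S' → ∃ σ : Equiv.Perm (Fin 3), ∀ i, Complex.exp ((c'' w i : ℂ) * I) = Complex.exp ((c w (σ i) : ℂ) * I) := by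
    intro w hw
    obtain ⟨σ, hσ⟩ := hplace w
    refine ⟨σ, fun i => ?_⟩
    have h := hσ i
    rw [if_neg hw, if_neg hw] at h
    exact h
  choose σc hσc using hcpt
  -- the partner permutation
  set ρ : {w : InfinitePlace L // IsComplex w} → Equiv.Perm (Fin 3) := fun w => if hw : w ∈ S' then 1 else σc w hw with hρ
  have hρmem : ρ ∈ partnerPerms S' := (mem_partnerPerms_iff S' ρ).2 fun w hw => by simp only [hρ, dif_pos hw]
  refine ⟨ρ, hρmem, ?_⟩
  -- flip back the `−x` places
  set T : Finset {w : InfinitePlace L // IsComplex w} := S'.filter fun w => c'' w 0 = -(c w 0) with hT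
  have hTS : T ⊆ S' := Finset.filter_subset _ _
  have hflip := isConj_gprimeTorus_flip L α S' c'' hS' T hTS
  -- after the flip the chart point IS the partner point
  have heq : gprimeTorus L α S' (fun w => if w ∈ T then ![-(c'' w 0), c'' w 1, c'' w 2] else c'' w) = gprimeTorus L α S' (slotPerm ρ c) := by
    apply (archPiEquivCM 3 L (Matrix.diagonal α)).injective
    funext w
    rw [archPiEquivCM_gprimeTorus, archPiEquivCM_gprimeTorus]
    apply Subtype.ext
    by_cases hw : w ∈ S'
    · obtain ⟨h0, h1, h2⟩ := hsplit w hw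
      have hρw : slotPerm ρ c w = c w := slotPerm_apply_of_eq_one (by simp only [hρ, dif_pos hw]) c
      rw [coe_gprimeBlock_of_mem L α _ hw (hS' w hw), coe_gprimeBlock_of_mem L α _ hw (hS' w hw), hρw]
      by_cases hwT : w ∈ T
      · have hneg : c'' w 0 = -(c w 0) := (Finset.mem_filter.1 hwT).2
        rw [if_pos hwT]
        refine gprimeSplitGL_congr _ _ ?_ ?_ ?_
        · simp [hneg]
        · simpa using h1
        · simpa using h2
      · have hpos : c'' w 0 = c w 0 := by
          rcases h0 with h | h
          · exact h
          · exact absurd (Finset.mem_filter.2 ⟨hw, h⟩) hwT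
        rw [if_neg hwT]
        exact gprimeSplitGL_congr _ _ hpos h1 h2
    · have hwT : w ∉ T := fun h => hw (hTS h)
      rw [coe_gprimeBlock_of_not_mem L α _ hw, coe_gprimeBlock_of_not_mem L α _ hw, if_neg hwT]
      refine gprimeCptGL_congr _ fun i => ?_
      rw [hσc w hw i, slotPerm_apply, hρ]
      simp only [dif_neg hw]
  -- assemble the classes
  rw [← hout, hconj, ConjClasses.mk_eq_mk_iff_isConj]
  refine ((isConj_iff.2 ⟨g, rfl⟩).symm).trans ?_
  rw [← heq]
  exact hflip

end Partner

end Literature.NumberTheory.Automorphic.UnitaryGroup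

end
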